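import Summits.NavierStokesRegularity.NavierStokesRegularity.Theses.PumpContinuation

/-!
# Route PumpContinuation · assembly `Assembly` (stmt-NavierStokesRegularity-18305) — PROOF

`Assembly : EulerProximatePump → BoundedTemperatureClosed → MildBlowupClassical → ¬ NavierStokesRegularity`
is, verbatim, the statement of the route's deciding theorem
`Summit.NavierStokesRegularity.NavierStokesRegularity.Theses.PumpContinuation.closes` (route file
`Theses/PumpContinuation.lean`, sorry-free): the Door gives `𝒜`, `M` and parameters `θ → 1` in the
bounded-temperature blow-up set, the Link makes that set closed so `θ = 1` belongs to it, at `θ = 1`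
the segment form is the Euler form, `MildBlowupClassical` turns the mild Type-I blow-up into X5a, and
`Literature.NS.blowup_assembly` with the proved X5b `Theorems.blowup_clay_uniqueness` refutes Clay (A).
This file records the composition under the item's name.

## References

* T. Tao, *Finite time blowup for an averaged three-dimensional Navier–Stokes equation*,
  J. Amer. Math. Soc. 29 (2016), arXiv:1402.0290. [Tao2016AveragedNS]
-/

-- the nested summit namespace `…NavierStokesRegularity.NavierStokesRegularity…` is the tree's layout
-- (D-0017), so the duplicated-namespace linter must be silenced for the declaration below
set_option linter.dupNamespace false

namespace Summit.NavierStokesRegularity.NavierStokesRegularity.Theorems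

/-- **Assembly of route PumpContinuation** (stmt-NavierStokesRegularity-18305): the Door
(`EulerProximatePump`), the Link (`BoundedTemperatureClosed`) and the mild-to-classical bookkeeping
(`MildBlowupClassical`) together refute `NavierStokesRegularity` — by the route's deciding theorem
`Theses.PumpContinuation.closes`. -/
theorem pumpContinuation_assembly_proof : Theses.PumpContinuation.Assembly := by
  unfold Theses.PumpContinuation.Assembly
  exact Theses.PumpContinuation.closes

end Summit.NavierStokesRegularity.NavierStokesRegularity.Theorems
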